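import Mathlib
import HarnessLib

/-!
# Stub `stub_relativeBookkeeping` for the crux `WeakCouplingHypercubicLimit` (line `Sketch`)

**Splitting off the vacuum index** (pure `tsum` bookkeeping).  Normalised weights
`0 ≤ rᵢ ≤ 1`, `r_{i₀} = 1`, `rᵢ ≤ e^{−g}` for `i ≠ i₀`; a non-negative "squared matrix" `sq j i`
with column sums `Σⱼ sq j i ≤ B²`, a "diagonal" `dg i` with `|dg i| ≤ B` and `dg i₀² = sq i₀ i₀`;
a number `0 ≤ X ≤ 1` dominating the trace excesses `Σᵢ rᵢ^m − 1` at the exponents used.  Then,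
with `D(e₁,e₂) = Σ_{(i,j)} rⱼ^{e₁} rᵢ^{e₂} sq j i`, `E = Σᵢ rᵢ^p dg i`, `Z = Σᵢ rᵢ^N` and
`0 ≤ g' ≤ g`,

  `|D(n+1, M)/Z − (E/Z)²| ≤ e^{−g' n} (D(1, M₀)/Z − (E/Z)²) + 16 B² X`.

Proof.  Write `Z = 1 + X_N` (`0 ≤ X_N ≤ X`), `E = c + e` with `c = dg i₀`, `|e| ≤ B X`;
iterating the double sum (`Summable.tsum_prod`) and splitting `i = i₀ / i ≠ i₀`,
`j = i₀ / j ≠ i₀` gives `D(k, L) = c² + P_k + E_{k,L}` with `P_k = Σ_{j ≠ i₀} rⱼ^k sq j i₀ ≥ 0`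
and `0 ≤ E_{k,L} ≤ B² X`; termwise `P_{n+1} ≤ e^{−g' n} P_1`.  The rest is an inequality
between real numbers (`θ := c² X_N − 2 c e − e²` is `n`-independent with `|θ| ≤ 4 B² X`).
[folklore]
-/

noncomputable section

open scoped BigOperators

namespace Summit.QuantumFields.YangMills.Theorems.WeakCouplingHypercubicLimit.TraceNormColdPressure

/-- Comparison of two summable real families off one index: if `u i ≤ v i` for all `i ≠ i₀`,
then `Σ u − u i₀ ≤ Σ v − v i₀`. [folklore] -/
private theorem tsum_sub_le_of_le_off {ι : Type*} (i₀ : ι) {u v : ι → ℝ} (hu : Summable u)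
    (hv : Summable v) (h : ∀ i, i ≠ i₀ → u i ≤ v i) :
    (∑' i, u i) - u i₀ ≤ (∑' i, v i) - v i₀ := by
  classical
  rw [hu.tsum_eq_add_tsum_ite i₀, hv.tsum_eq_add_tsum_ite i₀, add_sub_cancel_left,
    add_sub_cancel_left]
  have hu' : Summable fun i => ite (i = i₀) 0 (u i) := by
    have := hu.update i₀ 0
    rwa [show Function.update u i₀ 0 = fun i => ite (i = i₀) 0 (u i) from
      funext fun i => Function.update_apply u i₀ 0 i] at this
  have hv' : Summable fun i => ite (i = i₀) 0 (v i) := by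
    have := hv.update i₀ 0
    rwa [show Function.update v i₀ 0 = fun i => ite (i = i₀) 0 (v i) from
      funext fun i => Function.update_apply v i₀ 0 i] at this
  refine hu'.tsum_le_tsum (fun i => ?_) hv'
  split_ifs with hi
  · exact le_rfl
  · exact h i hi

/-- A weighted column sum of the squared matrix is at most `B² rᵢ^L`. [folklore] -/
private theorem col_le {ι : Type*} (r : ι → ℝ) (sq : ι → ι → ℝ) (B : ℝ) (k L : ℕ) (i : ι)
    (hr : ∀ i, 0 ≤ r i ∧ r i ≤ 1) (hsq0 : ∀ j i, 0 ≤ sq j i)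
    (hsq : Summable (fun j => sq j i) ∧ ∑' j, sq j i ≤ B ^ 2)
    (hu : Summable fun j => r j ^ k * r i ^ L * sq j i) :
    ∑' j, r j ^ k * r i ^ L * sq j i ≤ B ^ 2 * r i ^ L := by
  calc ∑' j, r j ^ k * r i ^ L * sq j i ≤ ∑' j, r i ^ L * sq j i :=
        hu.tsum_le_tsum (fun j => by
          rw [mul_assoc]
          exact mul_le_of_le_one_left (mul_nonneg (pow_nonneg (hr i).1 L) (hsq0 j i))
            (pow_le_one₀ (hr j).1 (hr j).2)) (hsq.1.mul_left _)
    _ = r i ^ L * ∑' j, sq j i := tsum_mul_left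
    _ ≤ r i ^ L * B ^ 2 := mul_le_mul_of_nonneg_left hsq.2 (pow_nonneg (hr i).1 L)
    _ = B ^ 2 * r i ^ L := mul_comm _ _

/-- Structure of the two-point sum `D(k, L) = Σ_{(i,j)} rⱼ^k rᵢ^L sq j i`: its `i₀`-column
`T = Σⱼ rⱼ^k r_{i₀}^L sq j i₀` satisfies `0 ≤ D − T ≤ B² X` and `T − sq i₀ i₀ ≥ 0`. [folklore] -/
private theorem twoPoint_split {ι : Type*} (i₀ : ι) (r : ι → ℝ) (sq : ι → ι → ℝ) (B X : ℝ)
    (k L : ℕ) (hr : ∀ i, 0 ≤ r i ∧ r i ≤ 1) (hr0 : r i₀ = 1) (hsq0 : ∀ j i, 0 ≤ sq j i)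
    (hsq : ∀ i, Summable (fun j => sq j i) ∧ ∑' j, sq j i ≤ B ^ 2)
    (hL : Summable (fun i => r i ^ L)) (hXL : (∑' i, r i ^ L) - 1 ≤ X)
    (hD : Summable (fun pr : ι × ι => r pr.2 ^ k * r pr.1 ^ L * sq pr.2 pr.1)) :
    0 ≤ (∑' pr : ι × ι, r pr.2 ^ k * r pr.1 ^ L * sq pr.2 pr.1) -
        ∑' j, r j ^ k * r i₀ ^ L * sq j i₀ ∧
      (∑' pr : ι × ι, r pr.2 ^ k * r pr.1 ^ L * sq pr.2 pr.1) -
        ∑' j, r j ^ k * r i₀ ^ L * sq j i₀ ≤ B ^ 2 * X ∧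
      0 ≤ (∑' j, r j ^ k * r i₀ ^ L * sq j i₀) - sq i₀ i₀ := by
  have hfib : ∀ i, Summable fun j => r j ^ k * r i ^ L * sq j i := fun i => hD.prod_factor i
  have hA : Summable fun i => ∑' j, r j ^ k * r i ^ L * sq j i := hD.prod
  have hsplit : (∑' pr : ι × ι, r pr.2 ^ k * r pr.1 ^ L * sq pr.2 pr.1) =
      ∑' i, ∑' j, r j ^ k * r i ^ L * sq j i := hD.tsum_prod
  have hnn : ∀ i j, 0 ≤ r j ^ k * r i ^ L * sq j i := fun i j =>
    mul_nonneg (mul_nonneg (pow_nonneg (hr j).1 k) (pow_nonneg (hr i).1 L)) (hsq0 j i)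
  have hAnn : ∀ i, 0 ≤ ∑' j, r j ^ k * r i ^ L * sq j i := fun i => tsum_nonneg (hnn i)
  refine ⟨?_, ?_, ?_⟩
  · rw [hsplit, sub_nonneg]
    exact hA.le_tsum i₀ (fun i _ => hAnn i)
  · rw [hsplit]
    have H := tsum_sub_le_of_le_off i₀ hA (hL.mul_left (B ^ 2))
      (fun i _ => col_le r sq B k L i hr hsq0 (hsq i) (hfib i))
    have hBsum : ∑' i, B ^ 2 * r i ^ L = B ^ 2 * ∑' i, r i ^ L := tsum_mul_left
    have hv0 : B ^ 2 * r i₀ ^ L = B ^ 2 := by rw [hr0, one_pow, mul_one]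
    rw [hBsum, hv0] at H
    linarith [mul_le_mul_of_nonneg_left hXL (sq_nonneg B)]
  · rw [sub_nonneg]
    have h0 : r i₀ ^ k * r i₀ ^ L * sq i₀ i₀ = sq i₀ i₀ := by
      rw [hr0, one_pow, one_pow, one_mul, one_mul]
    have := (hfib i₀).le_tsum i₀ (fun j _ => hnn i₀ j)
    rwa [h0] at this

/-- The key decay `P_{n+1} ≤ e^{−g' n} P_1` of the off-vacuum part of the `i₀`-column
(termwise: `rⱼ^{n+1} ≤ e^{−g n} rⱼ ≤ e^{−g' n} rⱼ` for `j ≠ i₀`). [folklore] -/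
private theorem P_le {ι : Type*} (i₀ : ι) (r : ι → ℝ) (sq : ι → ι → ℝ) (g g' : ℝ) (n M M₀ : ℕ)
    (hr : ∀ i, 0 ≤ r i ∧ r i ≤ 1) (hr0 : r i₀ = 1) (hg'g : g' ≤ g)
    (hgap : ∀ i, i ≠ i₀ → r i ≤ Real.exp (-g)) (hsq0 : ∀ j i, 0 ≤ sq j i)
    (hu : Summable fun j => r j ^ (n + 1) * r i₀ ^ M * sq j i₀)
    (hv : Summable fun j => r j ^ 1 * r i₀ ^ M₀ * sq j i₀) :
    (∑' j, r j ^ (n + 1) * r i₀ ^ M * sq j i₀) - sq i₀ i₀ ≤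
      Real.exp (-(g' * n)) * ((∑' j, r j ^ 1 * r i₀ ^ M₀ * sq j i₀) - sq i₀ i₀) := by
  have ha : ∀ j, j ≠ i₀ → r j ^ n ≤ Real.exp (-(g' * n)) := fun j hj => by
    have h1 : r j ≤ Real.exp (-g') := (hgap j hj).trans (Real.exp_le_exp.mpr (by linarith))
    calc r j ^ n ≤ Real.exp (-g') ^ n := pow_le_pow_left₀ (hr j).1 h1 n
      _ = Real.exp (-(g' * n)) := by
          rw [← Real.exp_nat_mul]
          congr 1
          ring
  have H := tsum_sub_le_of_le_off i₀ hu (hv.mul_left (Real.exp (-(g' * n)))) (fun j hj => by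
    show r j ^ (n + 1) * r i₀ ^ M * sq j i₀ ≤ Real.exp (-(g' * n)) * (r j ^ 1 * r i₀ ^ M₀ * sq j i₀)
    rw [hr0, one_pow, one_pow, mul_one, mul_one, pow_one, pow_succ, mul_assoc]
    exact mul_le_mul_of_nonneg_right (ha j hj) (mul_nonneg (hr j).1 (hsq0 j i₀)))
  have hu0 : r i₀ ^ (n + 1) * r i₀ ^ M * sq i₀ i₀ = sq i₀ i₀ := by
    rw [hr0, one_pow, one_pow, one_mul, one_mul]
  have hv0 : Real.exp (-(g' * n)) * (r i₀ ^ 1 * r i₀ ^ M₀ * sq i₀ i₀) =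
      Real.exp (-(g' * n)) * sq i₀ i₀ := by
    rw [hr0, one_pow, one_pow, one_mul, one_mul]
  have hvs : ∑' j, Real.exp (-(g' * n)) * (r j ^ 1 * r i₀ ^ M₀ * sq j i₀) =
      Real.exp (-(g' * n)) * ∑' j, r j ^ 1 * r i₀ ^ M₀ * sq j i₀ := tsum_mul_left
  rw [hu0, hv0, hvs] at H
  rw [mul_sub]
  exact H

/-- The one-point sum splits as `E = dg i₀ + e` with `|e| ≤ B X`. [folklore] -/
private theorem onePoint_split {ι : Type*} (i₀ : ι) (r : ι → ℝ) (dg : ι → ℝ) (B X : ℝ) (p : ℕ)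
    (hr : ∀ i, 0 ≤ r i ∧ r i ≤ 1) (hr0 : r i₀ = 1) (hdg : ∀ i, |dg i| ≤ B)
    (hp : Summable (fun i => r i ^ p)) (hXp : (∑' i, r i ^ p) - 1 ≤ X)
    (hE : Summable (fun i => r i ^ p * dg i)) :
    |(∑' i, r i ^ p * dg i) - dg i₀| ≤ B * X := by
  have hB : 0 ≤ B := (abs_nonneg _).trans (hdg i₀)
  have hup := tsum_sub_le_of_le_off i₀ hE (hp.mul_left B) (fun i _ => by
    show r i ^ p * dg i ≤ B * r i ^ p
    rw [mul_comm]
    exact mul_le_mul_of_nonneg_right (le_of_abs_le (hdg i)) (pow_nonneg (hr i).1 p))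
  have hlo := tsum_sub_le_of_le_off i₀ (hp.mul_left (-B)) hE (fun i _ => by
    show -B * r i ^ p ≤ r i ^ p * dg i
    rw [mul_comm (r i ^ p)]
    exact mul_le_mul_of_nonneg_right (neg_le_of_abs_le (hdg i)) (pow_nonneg (hr i).1 p))
  have h1 : ∑' i, B * r i ^ p = B * ∑' i, r i ^ p := tsum_mul_left
  have h2 : ∑' i, -B * r i ^ p = -B * ∑' i, r i ^ p := tsum_mul_left
  have h3 : r i₀ ^ p * dg i₀ = dg i₀ := by rw [hr0, one_pow, one_mul]
  have h4 : r i₀ ^ p = 1 := by rw [hr0, one_pow]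
  rw [h1, h3, h4, mul_one] at hup
  rw [h2, h3, h4, mul_one] at hlo
  rw [abs_le]
  constructor <;> linarith [mul_le_mul_of_nonneg_left hXp hB]

/-- The real-number inequality behind the bookkeeping: with `Z ≥ 1`, `Z − 1 ≤ X ≤ 1`,
`|c| ≤ B`, `|E − c| ≤ B X`, `0 ≤ Tₙ − c² ≤ a (T₀ − c²)`, `0 ≤ a ≤ 1`, `0 ≤ Dₙ − Tₙ ≤ B² X`,
`0 ≤ D₀ − T₀`, one has `|Dₙ/Z − (E/Z)²| ≤ a (D₀/Z − (E/Z)²) + 16 B² X`. [folklore] -/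
private theorem real_bookkeeping {Z c E Dn D0 Tn T0 s a B X : ℝ}
    (hZ1 : 1 ≤ Z) (hZX : Z - 1 ≤ X) (hX0 : 0 ≤ X) (hX1 : X ≤ 1) (hB : 0 ≤ B)
    (hc : |c| ≤ B) (hcs : c ^ 2 = s) (he : |E - c| ≤ B * X)
    (hPn : 0 ≤ Tn - s) (hP0 : 0 ≤ T0 - s) (hPa : Tn - s ≤ a * (T0 - s)) (ha0 : 0 ≤ a)
    (ha1 : a ≤ 1) (hEn0 : 0 ≤ Dn - Tn) (hEn : Dn - Tn ≤ B ^ 2 * X) (hE00 : 0 ≤ D0 - T0) :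
    |Dn / Z - (E / Z) ^ 2| ≤ a * (D0 / Z - (E / Z) ^ 2) + 16 * B ^ 2 * X := by
  subst hcs
  have hZ : 0 < Z := by linarith
  have hZ2 : 0 < Z ^ 2 := by positivity
  have hBX : 0 ≤ B ^ 2 * X := mul_nonneg (sq_nonneg B) hX0
  -- the `n`-independent part `θ`
  obtain ⟨θ, hθ⟩ : ∃ θ : ℝ, θ = c ^ 2 * (Z - 1) - 2 * (c * (E - c)) - (E - c) ^ 2 := ⟨_, rfl⟩
  have hθabs : |θ| ≤ 4 * B ^ 2 * X := by
    have hc2 : c ^ 2 ≤ B ^ 2 := sq_le_sq' (neg_le_of_abs_le hc) (le_of_abs_le hc)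
    have h1 : 0 ≤ c ^ 2 * (Z - 1) := mul_nonneg (sq_nonneg c) (by linarith)
    have h2 : c ^ 2 * (Z - 1) ≤ B ^ 2 * X := mul_le_mul hc2 hZX (by linarith) (sq_nonneg _)
    have hce : |c * (E - c)| ≤ B * (B * X) := by
      rw [abs_mul]
      exact mul_le_mul hc he (abs_nonneg _) hB
    obtain ⟨h3, h4⟩ := abs_le.mp hce
    have he2 : (E - c) ^ 2 ≤ (B * X) ^ 2 := sq_le_sq' (neg_le_of_abs_le he) (le_of_abs_le he)
    have h5 : (B * X) ^ 2 ≤ B ^ 2 * X := by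
      rw [mul_pow]
      exact mul_le_mul_of_nonneg_left (by nlinarith) (sq_nonneg B)
    rw [abs_le]
    constructor <;> nlinarith [sq_nonneg (E - c)]
  -- numerators
  have hNn : Dn / Z - (E / Z) ^ 2 = (θ + ((Tn - c ^ 2) + (Dn - Tn)) * Z) / Z ^ 2 := by
    rw [hθ]
    field_simp
    ring
  have hN0 : D0 / Z - (E / Z) ^ 2 = (θ + ((T0 - c ^ 2) + (D0 - T0)) * Z) / Z ^ 2 := by
    rw [hθ]
    field_simp
    ring
  obtain ⟨hθlo, hθup⟩ := abs_le.mp hθabs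
  have f1 : (Tn - c ^ 2) * Z ≤ a * (T0 - c ^ 2) * Z := mul_le_mul_of_nonneg_right hPa hZ.le
  have f2 : (Dn - Tn) * Z ≤ B ^ 2 * X * Z := mul_le_mul_of_nonneg_right hEn hZ.le
  have f3 : 0 ≤ B ^ 2 * X * Z * (Z - 1) := mul_nonneg (mul_nonneg hBX hZ.le) (by linarith)
  have f4 : (1 - a) * θ ≤ (1 - a) * (4 * B ^ 2 * X) :=
    mul_le_mul_of_nonneg_left hθup (by linarith)
  have f5 : 0 ≤ B ^ 2 * X * (Z ^ 2 - 1) := mul_nonneg hBX (by nlinarith)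
  have f6 : 0 ≤ a * (D0 - T0) * Z := mul_nonneg (mul_nonneg ha0 hE00) hZ.le
  have f7 : 0 ≤ a * (B ^ 2 * X) := mul_nonneg ha0 hBX
  have f8 : 0 ≤ B ^ 2 * X * Z ^ 2 := mul_nonneg hBX hZ2.le
  have l1 : 0 ≤ (Tn - c ^ 2) * Z := mul_nonneg hPn hZ.le
  have l2 : 0 ≤ (Dn - Tn) * Z := mul_nonneg hEn0 hZ.le
  have l3 : a * -(4 * B ^ 2 * X) ≤ a * θ := mul_le_mul_of_nonneg_left hθlo ha0
  have l4 : 0 ≤ a * (T0 - c ^ 2) * Z := mul_nonneg (mul_nonneg ha0 hP0) hZ.le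
  have l5 : 0 ≤ (1 - a) * (B ^ 2 * X) := mul_nonneg (by linarith) hBX
  have hup : θ + ((Tn - c ^ 2) + (Dn - Tn)) * Z ≤
      a * (θ + ((T0 - c ^ 2) + (D0 - T0)) * Z) + 16 * B ^ 2 * X * Z ^ 2 := by
    linarith
  have hlo : -(θ + ((Tn - c ^ 2) + (Dn - Tn)) * Z) ≤
      a * (θ + ((T0 - c ^ 2) + (D0 - T0)) * Z) + 16 * B ^ 2 * X * Z ^ 2 := by
    linarith
  have hfin : ∀ Nn N0 : ℝ, Nn ≤ a * N0 + 16 * B ^ 2 * X * Z ^ 2 →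
      Nn / Z ^ 2 ≤ a * (N0 / Z ^ 2) + 16 * B ^ 2 * X := by
    intro Nn N0 h
    have h' := div_le_div_of_nonneg_right h hZ2.le
    rwa [add_div, mul_div_assoc, mul_div_cancel_right₀ _ (ne_of_gt hZ2)] at h'
  rw [hNn, hN0, abs_le]
  refine ⟨?_, hfin _ _ hup⟩
  have := hfin _ _ hlo
  rw [neg_div] at this
  linarith

/-- **Splitting off the vacuum index.**  Normalised weights `0 ≤ rᵢ ≤ 1`, `r_{i₀} = 1`,
`rᵢ ≤ e^{−g}` for `i ≠ i₀`; a non-negative "squared matrix" `sq j i` with column sums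
`Σⱼ sq j i ≤ B²`, a "diagonal" `dg i` with `|dg i| ≤ B` and `dg i₀² = sq i₀ i₀`; a number
`0 ≤ X ≤ 1` dominating the trace excesses `Σᵢ rᵢ^m − 1` at the four exponents used (all sums
summable).  Then, with `D(e₁,e₂) = Σ_{(i,j)} rⱼ^{e₁} rᵢ^{e₂} sq j i`, `E = Σᵢ rᵢ^p dg i`,
`Z = Σᵢ rᵢ^N` and `0 ≤ g' ≤ g`:
`|D(n+1, M)/Z − (E/Z)²| ≤ e^{−g' n} (D(1, M₀)/Z − (E/Z)²) + 16 B² X`. [folklore] -/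
theorem stub_relativeBookkeeping :
    ∀ (ι : Type) (i₀ : ι) (r : ι → ℝ) (sq : ι → ι → ℝ) (dg : ι → ℝ) (B g g' X : ℝ) (n M M₀ p N : ℕ),
      (∀ i, 0 ≤ r i ∧ r i ≤ 1) → r i₀ = 1 → 0 ≤ g' → g' ≤ g → (∀ i, i ≠ i₀ → r i ≤ Real.exp (-g)) →
      (∀ j i, 0 ≤ sq j i) → (∀ i, Summable (fun j => sq j i) ∧ ∑' j, sq j i ≤ B ^ 2) →
      (∀ i, |dg i| ≤ B) → dg i₀ ^ 2 = sq i₀ i₀ → 0 ≤ X → X ≤ 1 →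
      Summable (fun i => r i ^ M) → Summable (fun i => r i ^ M₀) → Summable (fun i => r i ^ p) →
      Summable (fun i => r i ^ N) →
      (∑' i, r i ^ M) - 1 ≤ X → (∑' i, r i ^ M₀) - 1 ≤ X → (∑' i, r i ^ p) - 1 ≤ X → (∑' i, r i ^ N) - 1 ≤ X →
      Summable (fun pr : ι × ι => r pr.2 ^ (n + 1) * r pr.1 ^ M * sq pr.2 pr.1) →
      Summable (fun pr : ι × ι => r pr.2 ^ 1 * r pr.1 ^ M₀ * sq pr.2 pr.1) →
      Summable (fun i => r i ^ p * dg i) →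
      |(∑' pr : ι × ι, r pr.2 ^ (n + 1) * r pr.1 ^ M * sq pr.2 pr.1) / (∑' i, r i ^ N) -
          ((∑' i, r i ^ p * dg i) / (∑' i, r i ^ N)) ^ 2| ≤
        Real.exp (-(g' * n)) * ((∑' pr : ι × ι, r pr.2 ^ 1 * r pr.1 ^ M₀ * sq pr.2 pr.1) / (∑' i, r i ^ N) -
          ((∑' i, r i ^ p * dg i) / (∑' i, r i ^ N)) ^ 2) + 16 * B ^ 2 * X := by
  intro ι i₀ r sq dg B g g' X n M M₀ p N hr hr0 hg' hg'g hgap hsq0 hsq hdg hdiag hX0 hX1 hM hM₀ hp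
    hN hXM hXM₀ hXp hXN hDn hD0 hE
  have hB : 0 ≤ B := (abs_nonneg _).trans (hdg i₀)
  have hZ1 : 1 ≤ ∑' i, r i ^ N := by
    have h1 : r i₀ ^ N = 1 := by rw [hr0, one_pow]
    have := hN.le_tsum i₀ (fun j _ => pow_nonneg (hr j).1 N)
    rwa [h1] at this
  obtain ⟨hEn0, hEn, hPn⟩ := twoPoint_split i₀ r sq B X (n + 1) M hr hr0 hsq0 hsq hM hXM hDn
  obtain ⟨hE00, _hE0, hP0⟩ := twoPoint_split i₀ r sq B X 1 M₀ hr hr0 hsq0 hsq hM₀ hXM₀ hD0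
  have hPa := P_le i₀ r sq g g' n M M₀ hr hr0 hg'g hgap hsq0 (hDn.prod_factor i₀)
    (hD0.prod_factor i₀)
  have he := onePoint_split i₀ r dg B X p hr hr0 hdg hp hXp hE
  have ha0 : 0 ≤ Real.exp (-(g' * n)) := (Real.exp_pos _).le
  have ha1 : Real.exp (-(g' * n)) ≤ 1 := by
    rw [Real.exp_le_one_iff]
    have : 0 ≤ g' * n := mul_nonneg hg' (Nat.cast_nonneg n)
    linarith
  exact real_bookkeeping hZ1 hXN hX0 hX1 hB (hdg i₀) hdiag he hPn hP0 hPa ha0 ha1 hEn0 hEn hE00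

end Summit.QuantumFields.YangMills.Theorems.WeakCouplingHypercubicLimit.TraceNormColdPressure

end
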